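import Summits.Ventures.LatticeQCDFlow.Scaling.ReplicaExchangeBareSampler
import Summits.Ventures.LatticeQCDFlow.Scaling.ReplicaExchangeModeTorpid

/-!
HONEST FRAMING: exact (Metropolis-corrected) sampling algorithms for lattice gauge theory; figures
of merit are autocorrelation/cost numbers at stated couplings and volumes; no continuum-physics
claim.

# ReplicaExchangeBareAcceptance — THE STATIONARY SWAP ACCEPTANCE OF AN ADJACENT PAIR IS A TWO-LEVEL QUANTITY,
# `α_j = Σ_{u,w} min{μ_j(u)μ_{j+1}(w), μ_j(w)μ_{j+1}(u)}`, AND SEPARATED LEVELS KILL IT: FOR EVERY SET `B` OF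
# CONFIGURATIONS `α_j ≤ 1 − μ_j(Bᶜ)μ_{j+1}(B) + μ_j(B)μ_{j+1}(Bᶜ)` (lean-2 GEN-19, ours)

Venture-side (OURS).  Cell `lqcd-flow` (pub-lqcd), unit `pub-lqcd-lean-2-g19`, 2026-08-25.  Chapter R.  The stationary
acceptance `ptFinAcc μ j = Σ_x min{π̃(x), π̃(x∘σ_j)}` of `Scaling/ReplicaExchangeFiniteSampler` is the quantity through
which the number of replicas enters the diffusive ceiling of `Scaling/ReplicaExchangeDiffusiveAcceptance` linearly
(`Gap ≤ 3tα/(v·K(K+1)(2K+1))`).  Here it is reduced to the two adjacent level laws and bounded by their SEPARATION on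
any test set `B` (for tempering in a coupling: `B` = "action below a threshold"): if level `j` puts mass `≥ 1 − ε`
outside `B` and level `j+1` puts mass `≥ 1 − ε` inside, then `α_j ≤ 1 − (1−ε)² + ε² = 2ε`.  (The cell's
measure-level laws `Scaling/SwapAcceptanceOverlap` — `OVL² ≤ α ≤ OVL` for the exponential family — are the continuum
counterpart; this file is the finite-chain identity for arbitrary positive level laws.)

## What is proved

* §1 `prod_levels_split_two`; **`tensorFun_comp_levelSwap_mul`** —
  `π̃(x∘σ_j)·μ_j(x_j)μ_{j+1}(x_{j+1}) = π̃(x)·μ_j(x_{j+1})μ_{j+1}(x_j)`; `sum_tensorFun_mul_two_fun` — the two-coordinate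
  marginal `Σ_x π̃(x)φ(x_i, x_l) = Σ_{u,w} μ_i(u)μ_l(w)φ(u,w)` (`i ≠ l`).
* §2 **`ptFinAcc_eq_twoLevel`** — `α_j = Σ_u Σ_w min{μ_j(u)μ_{j+1}(w), μ_j(w)μ_{j+1}(u)}`;
  **`ptFinAcc_le_separation`** — `α_j ≤ 1 − μ_j(Bᶜ)μ_{j+1}(B) + μ_j(B)μ_{j+1}(Bᶜ)` for every `B : Finset S`;
  `ptFinAcc_le_one`.

NOT CLAIMED: lower bounds on `α_j` (overlap floors are chapter Y's `δ`); how `μ_j(B)` depends on volume and coupling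
(`Scaling/DefectSwapAcceptance` does that for PTBC); anything measured.  Literature grade (cell rule): FOLKLORE
(acceptance = expected min of likelihood ratios), NEW TYPING; nothing cited as a fact; no new bib keys.
-/

noncomputable section

open Finset Function
open Literature.Probability.MarkovChains

namespace Summit.Ventures.LatticeQCDFlow.Scaling

variable {S : Type*} [Fintype S] [DecidableEq S] {K : ℕ} {μ : Fin (K + 1) → S → ℝ}

/-! ## §1 The swapped weight and the two-coordinate marginal -/

omit [Fintype S] [DecidableEq S] in
/-- Splitting two factors off a product over the levels. [folklore] -/
theorem prod_levels_split_two (F : Fin (K + 1) → ℝ) {a b : Fin (K + 1)} (hab : a ≠ b) :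
    ∏ k, F k = F a * F b * ∏ k ∈ (univ.erase a).erase b, F k := by
  rw [← Finset.mul_prod_erase univ F (mem_univ a),
    ← Finset.mul_prod_erase (univ.erase a) F (Finset.mem_erase.mpr ⟨hab.symm, mem_univ b⟩)]
  ring

omit [Fintype S] [DecidableEq S] in
/-- **The swapped weight:** `π̃(x∘σ_j)·μ_j(x_j)μ_{j+1}(x_{j+1}) = π̃(x)·μ_j(x_{j+1})μ_{j+1}(x_j)` — the other levels'
factors agree. [ours] -/
theorem tensorFun_comp_levelSwap_mul (μ : Fin (K + 1) → S → ℝ) (x : Fin (K + 1) → S) (j : Fin K) :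
    tensorFun μ (x ∘ levelSwap j) * (μ j.castSucc (x j.castSucc) * μ j.succ (x j.succ))
      = tensorFun μ x * (μ j.castSucc (x j.succ) * μ j.succ (x j.castSucc)) := by
  have hne : j.castSucc ≠ j.succ := ne_of_lt Fin.castSucc_lt_succ
  have e1 : levelSwap j j.castSucc = j.succ := levelSwap_castSucc j
  have e2 : levelSwap j j.succ = j.castSucc := by unfold levelSwap; exact Equiv.swap_apply_right _ _
  unfold tensorFun
  rw [prod_levels_split_two (fun k => μ k ((x ∘ levelSwap j) k)) hne,
    prod_levels_split_two (fun k => μ k (x k)) hne]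
  have hrest : ∏ k ∈ (univ.erase j.castSucc).erase j.succ, μ k ((x ∘ levelSwap j) k)
      = ∏ k ∈ (univ.erase j.castSucc).erase j.succ, μ k (x k) := by
    refine prod_congr rfl fun k hk => ?_
    have h2 : k ≠ j.succ := Finset.ne_of_mem_erase hk
    have h1 : k ≠ j.castSucc := Finset.ne_of_mem_erase (Finset.mem_of_mem_erase hk)
    have e : levelSwap j k = k := by unfold levelSwap; exact Equiv.swap_apply_of_ne_of_ne h1 h2
    simp only [Function.comp_apply, e]
  rw [hrest]
  simp only [Function.comp_apply, e1, e2]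
  ring

omit [DecidableEq S] in
/-- **The two-coordinate marginal of the product law:** for `i ≠ l` and any `φ`,
`Σ_x π̃(x)·φ(x_i, x_l) = Σ_u Σ_w μ_i(u)μ_l(w)·φ(u,w)` (all `μ_k` of mass one). [folklore] -/
theorem sum_tensorFun_mul_two_fun [DecidableEq S] (hμ1 : ∀ k, ∑ u, μ k u = 1) {i l : Fin (K + 1)} (hil : i ≠ l)
    (φ : S → S → ℝ) :
    ∑ x : Fin (K + 1) → S, tensorFun μ x * φ (x i) (x l) = ∑ u, ∑ w, μ i u * μ l w * φ u w := by
  have hφ : ∀ x : Fin (K + 1) → S,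
      φ (x i) (x l) = ∑ u, ∑ w, (if u = x i then (1 : ℝ) else 0) * (if w = x l then (1 : ℝ) else 0) * φ u w := by
    intro x
    rw [Finset.sum_eq_single (x i) (fun u _ hu => by simp [hu]) (fun h => absurd (mem_univ _) h)]
    rw [Finset.sum_eq_single (x l) (fun w _ hw => by simp [hw]) (fun h => absurd (mem_univ _) h)]
    simp
  simp_rw [hφ, Finset.mul_sum]
  rw [Finset.sum_comm]
  refine sum_congr rfl fun u _ => ?_
  rw [Finset.sum_comm]
  refine sum_congr rfl fun w _ => ?_
  have key := sum_tensorFun_mul_two μ hμ1 hil (fun a => if u = a then (1 : ℝ) else 0) (fun b => if w = b then (1 : ℝ) else 0)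
  have e1 : ∑ a, μ i a * (if u = a then (1 : ℝ) else 0) = μ i u := by
    simp_rw [mul_ite, mul_one, mul_zero]; rw [Finset.sum_ite_eq univ u]; simp
  have e2 : ∑ b, μ l b * (if w = b then (1 : ℝ) else 0) = μ l w := by
    simp_rw [mul_ite, mul_one, mul_zero]; rw [Finset.sum_ite_eq univ w]; simp
  rw [e1, e2] at key
  calc ∑ x : Fin (K + 1) → S, tensorFun μ x * ((if u = x i then (1 : ℝ) else 0) * (if w = x l then (1 : ℝ) else 0) * φ u w)
      = (∑ x : Fin (K + 1) → S, tensorFun μ x * ((if u = x i then (1 : ℝ) else 0) * (if w = x l then (1 : ℝ) else 0)))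
          * φ u w := by
        rw [Finset.sum_mul]; exact sum_congr rfl fun x _ => by ring
    _ = μ i u * μ l w * φ u w := by rw [key]

/-! ## §2 The acceptance as a two-level quantity, and the separation bound -/

/-- **THE STATIONARY SWAP ACCEPTANCE IS A TWO-LEVEL QUANTITY:**
`α_j = Σ_u Σ_w min{μ_j(u)μ_{j+1}(w), μ_j(w)μ_{j+1}(u)}`. [ours] -/
theorem ptFinAcc_eq_twoLevel (hμ : ∀ k u, 0 < μ k u) (hμ1 : ∀ k, ∑ u, μ k u = 1) (j : Fin K) :
    ptFinAcc μ j = ∑ u, ∑ w, min (μ j.castSucc u * μ j.succ w) (μ j.castSucc w * μ j.succ u) := by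
  have hne : j.castSucc ≠ j.succ := ne_of_lt Fin.castSucc_lt_succ
  -- `min{π̃(x), π̃(x∘σ_j)} = π̃(x)·min{1, ρ(x_j, x_{j+1})}`
  have hmin : ∀ x : Fin (K + 1) → S, min (tensorFun μ x) (tensorFun μ (x ∘ levelSwap j))
      = tensorFun μ x * min 1 (μ j.castSucc (x j.succ) * μ j.succ (x j.castSucc)
          / (μ j.castSucc (x j.castSucc) * μ j.succ (x j.succ))) := by
    intro x
    have hpos : 0 < μ j.castSucc (x j.castSucc) * μ j.succ (x j.succ) := mul_pos (hμ _ _) (hμ _ _)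
    have hsw : tensorFun μ (x ∘ levelSwap j) = tensorFun μ x * (μ j.castSucc (x j.succ) * μ j.succ (x j.castSucc)
        / (μ j.castSucc (x j.castSucc) * μ j.succ (x j.succ))) := by
      rw [mul_div_assoc', eq_div_iff hpos.ne', tensorFun_comp_levelSwap_mul]
    rw [hsw, (monotone_mul_left_of_nonneg (tensorFun_pos hμ x).le).map_min, mul_one]
  unfold ptFinAcc
  simp_rw [hmin]
  rw [sum_tensorFun_mul_two_fun hμ1 hne (fun u w => min 1 (μ j.castSucc w * μ j.succ u / (μ j.castSucc u * μ j.succ w)))]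
  refine sum_congr rfl fun u _ => sum_congr rfl fun w _ => ?_
  have hpos : 0 < μ j.castSucc u * μ j.succ w := mul_pos (hμ _ _) (hμ _ _)
  rw [(monotone_mul_left_of_nonneg hpos.le).map_min, mul_one, mul_div_cancel₀ _ hpos.ne']

/-- **SEPARATED LEVELS KILL THE SWAP:** for every set of configurations `B`,
`α_j ≤ 1 − μ_j(Bᶜ)μ_{j+1}(B) + μ_j(B)μ_{j+1}(Bᶜ)`; if level `j` puts mass `≥ 1−ε` outside `B` and level `j+1` mass
`≥ 1−ε` inside, the stationary acceptance is `≤ 2ε`. [ours] -/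
theorem ptFinAcc_le_separation (hμ : ∀ k u, 0 < μ k u) (hμ1 : ∀ k, ∑ u, μ k u = 1) (j : Fin K) (B : Finset S) :
    ptFinAcc μ j ≤ 1 - (∑ u ∈ Bᶜ, μ j.castSucc u) * (∑ w ∈ B, μ j.succ w)
        + (∑ u ∈ B, μ j.castSucc u) * (∑ w ∈ Bᶜ, μ j.succ w) := by
  rw [ptFinAcc_eq_twoLevel hμ hμ1 j]
  set p := μ j.castSucc with hp
  set q := μ j.succ with hq
  -- termwise: keep `p(w)q(u)` when `u ∉ B, w ∈ B`, else `p(u)q(w)`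
  have hterm : ∀ u w, min (p u * q w) (p w * q u)
      ≤ p u * q w + (if u ∈ B then (0 : ℝ) else 1) * (if w ∈ B then (1 : ℝ) else 0) * (p w * q u - p u * q w) := by
    intro u w
    by_cases hu : u ∈ B
    · rw [if_pos hu]; simp only [zero_mul, add_zero]; exact min_le_left _ _
    · by_cases hw : w ∈ B
      · rw [if_neg hu, if_pos hw]; simp only [one_mul, add_sub_cancel]; exact min_le_right _ _
      · rw [if_neg hu, if_neg hw]; simp only [mul_zero, zero_mul, add_zero]; exact min_le_left _ _
  have hp1 : ∑ u, p u = 1 := hμ1 _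
  have hq1 : ∑ w, q w = 1 := hμ1 _
  have hpB : ∑ u, (if u ∈ B then (0 : ℝ) else 1) * p u = ∑ u ∈ Bᶜ, p u := by
    rw [← Finset.sum_add_sum_compl B]
    rw [Finset.sum_eq_zero (fun u hu => by rw [if_pos hu, zero_mul]), zero_add]
    exact sum_congr rfl fun u hu => by rw [if_neg (Finset.mem_compl.mp hu), one_mul]
  have hqB : ∑ w, (if w ∈ B then (1 : ℝ) else 0) * q w = ∑ w ∈ B, q w := by
    rw [← Finset.sum_add_sum_compl B]
    rw [Finset.sum_eq_zero (s := Bᶜ) (fun w hw => by rw [if_neg (Finset.mem_compl.mp hw), zero_mul]), add_zero]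
    exact sum_congr rfl fun w hw => by rw [if_pos hw, one_mul]
  have hpBq : ∑ u, (if u ∈ B then (0 : ℝ) else 1) * q u = ∑ u ∈ Bᶜ, q u := by
    rw [← Finset.sum_add_sum_compl B]
    rw [Finset.sum_eq_zero (fun u hu => by rw [if_pos hu, zero_mul]), zero_add]
    exact sum_congr rfl fun u hu => by rw [if_neg (Finset.mem_compl.mp hu), one_mul]
  have hqBp : ∑ w, (if w ∈ B then (1 : ℝ) else 0) * p w = ∑ w ∈ B, p w := by
    rw [← Finset.sum_add_sum_compl B]
    rw [Finset.sum_eq_zero (s := Bᶜ) (fun w hw => by rw [if_neg (Finset.mem_compl.mp hw), zero_mul]), add_zero]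
    exact sum_congr rfl fun w hw => by rw [if_pos hw, one_mul]
  calc ∑ u, ∑ w, min (p u * q w) (p w * q u)
      ≤ ∑ u, ∑ w, (p u * q w
          + (if u ∈ B then (0 : ℝ) else 1) * (if w ∈ B then (1 : ℝ) else 0) * (p w * q u - p u * q w)) :=
        sum_le_sum fun u _ => sum_le_sum fun w _ => hterm u w
    _ = (∑ u, p u) * (∑ w, q w)
        + ((∑ u, (if u ∈ B then (0 : ℝ) else 1) * q u) * (∑ w, (if w ∈ B then (1 : ℝ) else 0) * p w)
          - (∑ u, (if u ∈ B then (0 : ℝ) else 1) * p u) * (∑ w, (if w ∈ B then (1 : ℝ) else 0) * q w)) := by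
        rw [Finset.sum_mul_sum, Finset.sum_mul_sum, Finset.sum_mul_sum, ← Finset.sum_sub_distrib,
          ← Finset.sum_add_distrib]
        refine sum_congr rfl fun u _ => ?_
        rw [← Finset.sum_sub_distrib, ← Finset.sum_add_distrib]
        exact sum_congr rfl fun w _ => by ring
    _ = 1 - (∑ u ∈ Bᶜ, p u) * (∑ w ∈ B, q w) + (∑ u ∈ B, p u) * (∑ w ∈ Bᶜ, q w) := by
        rw [hp1, hq1, hpB, hqB, hpBq, hqBp]; ring

/-- The stationary acceptance is at most one. [ours] -/
theorem ptFinAcc_le_one (hμ : ∀ k u, 0 < μ k u) (hμ1 : ∀ k, ∑ u, μ k u = 1) (j : Fin K) : ptFinAcc μ j ≤ 1 := by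
  have h := ptFinAcc_le_separation hμ hμ1 j ∅
  simp at h
  linarith [h, hμ1 j.castSucc]

end Summit.Ventures.LatticeQCDFlow.Scaling

end
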